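import Summits.QuantumFields.YangMills.Theorems.FluctuationComparisonRegPrIntLS2BetaResidualGauge
import HarnessLib

/-!
# GAP♯∘'s KINEMATIC LETTER — THE `dist1`-ALGEBRA OF INTER₀∘ ([Balaban1985RegularSpaces] Lemma 1 (1.25), the bonds joining two blocks): three carrier-free group lemmas
# (crux `FluctuationComparisonRegPrIntL`, stmt-QuantumFields-20520; registry v11.4 `Cruxes/FluctuationComparisonRegPrIntL/Lines/semiclassical_s2beta.lean` 3732b7df FROZEN, untouched)

Cell `ym3-torus` (YM ladder rung R3 = continuum `SU(2)` Yang–Mills on the three-torus — a RUNG: NOT d = 4, NOT infinite volume, NOT a mass gap, NOT Clay).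
Seat `ymfull-r3-prover-3` (gen 0; R590-ym (a) item (3)); `--kind proof --supports stmt-QuantumFields-20520 --as helper`, count-neutral, DEFINITION-FREE (0 `def`, 0 `instance`,
0 `notation`, 0 `sorry`, default heartbeats).  Eighth file of the seat: the group-theoretic skeleton of the plan `LOCATE-INTER0-ymfull-r3-prover-3-g0.md` (HOME
`pub/ym3-torus/ymfull-r3-prover-3/g0/`) for the one displayed letter INTER₀∘ left on GAP♯∘'s closeness side after ✓`…S2BetaOneStepOfInterBlock`.

THE PLAN IT SERVES.  In the relative comb-axial gauge (`W` vs `Y`, one block level, finest lattice) a bond `ℓ₀` on the central axis joining two blocks sits INSIDE the straight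
transporter `U(c) = A·W(ℓ₀)·B` of the (0.4) average (`axialAvg`), with the SAME comb transporters `A, B` for `W` and `Y`; the average is `corr·U(c)` with `corr = ℰ(loops) =
1 + O(L²α₀)`; the other links of the face are reached by double-block loops whose `W`- and `Y`-holonomies carry the same `Y`-transporters.  The three lemmas below are
exactly the `dist1` bookkeeping of those three sentences, for ANY gauge group (`GaugeGroup`: `dist1_mul_le`, `dist1_inv`, `dist1_conj`):

* §1 `dist1_mul_inv_eq_of_conj_transport` — CENTRAL LINK ≡ STRAIGHT TRANSPORTERS: `aW = A·w·B`, `aY = A·y·B` ⟹ `dist1(w·y⁻¹) = dist1(aW·aY⁻¹)`.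
* §2 `dist1_transport_ratio_le_of_corr` — STRIP THE CORRECTION FACTORS: `avgW = cW·aW`, `avgY = cY·aY`, `dist1 cW ≤ ρ`, `dist1 cY ≤ ρ`, `dist1(avgW·avgY⁻¹) ≤ α₁`
  ⟹ `dist1(aW·aY⁻¹) ≤ α₁ + 2ρ` (coefficient ONE on `α₁` — the reason the (K−J)-fold iteration is depth-free, ✓`…S2BetaThresholdSum`).
* §3 `dist1_face_link_le` — THE OTHER LINKS OF THE FACE: `holW = A_z·w_z·B_z⁻¹·B₀·w₀⁻¹·A₀⁻¹`, `holY = A_z·y_z·B_z⁻¹·B₀·y₀⁻¹·A₀⁻¹` (same transporters)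
  ⟹ `dist1(w_z·y_z⁻¹) ≤ dist1 holW + dist1(w₀·y₀⁻¹) + dist1 holY`.
* §4 `dist1_face_link_le_of_bounds` — §1–§3 chained: the face-link bound `α₁ + 2ρ + 2σ` from the five displayed numbers (`σ` bounding the two loop holonomies).

HONEST: group algebra only (no lattice, no averaging, no estimate); INTER₀∘, TUBE-REG∘, GAP♯∘, EXW∘, S2β, crux 20520 are NOT proved here; no summit statement is proved by a helper;
finite-volume ∕ conditional; rung R3 = SU(2) YM₃ on T³ — NOT d = 4, NOT infinite volume, NOT a mass gap, NOT Clay; the Yang–Mills mass gap is NOT proved.  Sorry-free, axioms standard.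

References: T. Bałaban, CMP **99** (1985) 75–102 [Balaban1985RegularSpaces] (Lemma 1 (1.24)–(1.26) pp.79–80); CMP **98** (1985) 17–51 [Balaban1985Averaging] ((8)–(9) pp.18–19, pp.24–25);
CMP **109** (1987) 249–301 [Balaban1987RG1] ((0.4) p.253).
-/

set_option autoImplicit false

noncomputable section

open Literature.MathematicalPhysics.QuantumFieldTheory.Balaban1983to89

namespace Summit.QuantumFields.YangMills.Theorems.FluctuationComparisonRegPrIntLS2BetaInterBlockAlgebra

variable {G : Type*} [GaugeGroup G]

/-! ## §1 The central crossing link is conjugate to the ratio of the straight transporters -/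

/-- If the straight transporters of `W` and `Y` share their comb pieces, `aW = A·w·B` and `aY = A·y·B`, then `dist1(w·y⁻¹) = dist1(aW·aY⁻¹)` (`aW·aY⁻¹ = A·(w·y⁻¹)·A⁻¹`).
[cite: Balaban1985Averaging, (9) p.18; Balaban1985RegularSpaces, (1.19) p.79] -/
theorem dist1_mul_inv_eq_of_conj_transport (A w B y : G) :
    GaugeGroup.dist1 (w * y⁻¹) = GaugeGroup.dist1 ((A * w * B) * (A * y * B)⁻¹) := by
  have h : (A * w * B) * (A * y * B)⁻¹ = A * (w * y⁻¹) * A⁻¹ := by group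
  rw [h, GaugeGroup.dist1_conj]

/-! ## §2 Stripping the correction factors of the (0.4) average -/

/-- If `avgW = cW·aW`, `avgY = cY·aY` with `dist1 cW, dist1 cY ≤ ρ` and `dist1(avgW·avgY⁻¹) ≤ α₁`, then `dist1(aW·aY⁻¹) ≤ α₁ + 2ρ` — coefficient ONE on `α₁`.
[cite: Balaban1987RG1, (0.4) p.253; Balaban1985RegularSpaces, Lemma 1 (1.25) p.79] -/
theorem dist1_transport_ratio_le_of_corr {cW aW cY aY : G} {ρ α₁ : ℝ}
    (hW : GaugeGroup.dist1 cW ≤ ρ) (hY : GaugeGroup.dist1 cY ≤ ρ)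
    (havg : GaugeGroup.dist1 ((cW * aW) * (cY * aY)⁻¹) ≤ α₁) :
    GaugeGroup.dist1 (aW * aY⁻¹) ≤ α₁ + 2 * ρ := by
  have h : aW * aY⁻¹ = cW⁻¹ * ((cW * aW) * (cY * aY)⁻¹) * cY := by group
  rw [h]
  calc GaugeGroup.dist1 (cW⁻¹ * ((cW * aW) * (cY * aY)⁻¹) * cY)
      ≤ GaugeGroup.dist1 (cW⁻¹ * ((cW * aW) * (cY * aY)⁻¹)) + GaugeGroup.dist1 cY := GaugeGroup.dist1_mul_le _ _
    _ ≤ (GaugeGroup.dist1 cW⁻¹ + GaugeGroup.dist1 ((cW * aW) * (cY * aY)⁻¹)) + GaugeGroup.dist1 cY :=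
        add_le_add (GaugeGroup.dist1_mul_le _ _) le_rfl
    _ ≤ (ρ + α₁) + ρ := by
        rw [GaugeGroup.dist1_inv]
        exact add_le_add (add_le_add hW havg) hY
    _ = α₁ + 2 * ρ := by ring

/-! ## §3 The other links of a face, through a double-block loop -/

/-- If the `W`- and `Y`-holonomies of one double-block loop through the face links `ℓ_z` and `ℓ₀` carry the SAME transporters,
`holW = A_z·w_z·B_z⁻¹·B₀·w₀⁻¹·A₀⁻¹`, `holY = A_z·y_z·B_z⁻¹·B₀·y₀⁻¹·A₀⁻¹`, then `dist1(w_z·y_z⁻¹) ≤ dist1 holW + dist1(w₀·y₀⁻¹) + dist1 holY`.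
[cite: Balaban1985Averaging, (9) p.18 and pp.24-25; Balaban1985RegularSpaces, Lemma 1 (1.25) p.79] -/
theorem dist1_face_link_le (Az wz Bz B₀ w₀ A₀ yz y₀ : G) :
    GaugeGroup.dist1 (wz * yz⁻¹) ≤
      GaugeGroup.dist1 (Az * wz * Bz⁻¹ * B₀ * w₀⁻¹ * A₀⁻¹) + GaugeGroup.dist1 (w₀ * y₀⁻¹) +
        GaugeGroup.dist1 (Az * yz * Bz⁻¹ * B₀ * y₀⁻¹ * A₀⁻¹) := by
  set holW := Az * wz * Bz⁻¹ * B₀ * w₀⁻¹ * A₀⁻¹ with hholW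
  set holY := Az * yz * Bz⁻¹ * B₀ * y₀⁻¹ * A₀⁻¹ with hholY
  -- `w_z·y_z⁻¹ = A_z⁻¹·(holW·(A₀·(w₀·y₀⁻¹)·A₀⁻¹)·holY⁻¹)·A_z`
  have h : wz * yz⁻¹ = Az⁻¹ * (holW * (A₀ * (w₀ * y₀⁻¹) * A₀⁻¹) * holY⁻¹) * (Az⁻¹)⁻¹ := by
    rw [hholW, hholY]; group
  rw [h, GaugeGroup.dist1_conj]
  calc GaugeGroup.dist1 (holW * (A₀ * (w₀ * y₀⁻¹) * A₀⁻¹) * holY⁻¹)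
      ≤ GaugeGroup.dist1 (holW * (A₀ * (w₀ * y₀⁻¹) * A₀⁻¹)) + GaugeGroup.dist1 holY⁻¹ := GaugeGroup.dist1_mul_le _ _
    _ ≤ (GaugeGroup.dist1 holW + GaugeGroup.dist1 (A₀ * (w₀ * y₀⁻¹) * A₀⁻¹)) + GaugeGroup.dist1 holY⁻¹ :=
        add_le_add (GaugeGroup.dist1_mul_le _ _) le_rfl
    _ = GaugeGroup.dist1 holW + GaugeGroup.dist1 (w₀ * y₀⁻¹) + GaugeGroup.dist1 holY := by
        rw [GaugeGroup.dist1_conj, GaugeGroup.dist1_inv]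

/-! ## §4 The face-link bound from the five displayed numbers -/

/-- §1–§3 chained: central link inside the straight transporters (`aW = A·w₀·B`, `aY = A·y₀·B`), correction factors within `ρ`, averages `α₁`-close, the two double-block loop
holonomies within `σ` ⟹ every link of the face is within `α₁ + 2ρ + 2σ` — the shape of INTER₀∘'s conclusion with `C·α₀ := 2ρ + 2σ`.
[cite: Balaban1985RegularSpaces, Lemma 1 (1.24)-(1.26) pp.79-80] -/
theorem dist1_face_link_le_of_bounds {A B cW cY Az wz Bz B₀ w₀ A₀ yz y₀ : G} {ρ α₁ σ : ℝ}
    (hcW : GaugeGroup.dist1 cW ≤ ρ) (hcY : GaugeGroup.dist1 cY ≤ ρ)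
    (havg : GaugeGroup.dist1 ((cW * (A * w₀ * B)) * (cY * (A * y₀ * B))⁻¹) ≤ α₁)
    (hloopW : GaugeGroup.dist1 (Az * wz * Bz⁻¹ * B₀ * w₀⁻¹ * A₀⁻¹) ≤ σ)
    (hloopY : GaugeGroup.dist1 (Az * yz * Bz⁻¹ * B₀ * y₀⁻¹ * A₀⁻¹) ≤ σ) :
    GaugeGroup.dist1 (wz * yz⁻¹) ≤ α₁ + 2 * ρ + 2 * σ := by
  have h0 : GaugeGroup.dist1 (w₀ * y₀⁻¹) ≤ α₁ + 2 * ρ := by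
    rw [dist1_mul_inv_eq_of_conj_transport A w₀ B y₀]
    exact dist1_transport_ratio_le_of_corr hcW hcY havg
  have h1 := dist1_face_link_le Az wz Bz B₀ w₀ A₀ yz y₀
  linarith

end Summit.QuantumFields.YangMills.Theorems.FluctuationComparisonRegPrIntLS2BetaInterBlockAlgebra

end
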